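import Mathlib
import HarnessLib

/-!
# Stub `stub_windowForm` of line `birth` (crux `HiddenChargeMazur.DressedCharge`, item
stmt-AtomisticToContinuum-13509; `--supports` helper, closes nothing)

Last step of the algebraic proof of S1: if the lattice polynomial `G ∈ MvPolynomial (ℤ ⊕ ℤ) ℝ`
of a momentum-odd window density `g` (sites re-indexed to `[-R, R]`) is a shift-coboundary up to
a constant, `G = C c + H − τH` (`τ = rename (Sum.map (·+1) (·+1))`), then
`g(y) = k(y ∘ Fin.succ) − k(y ∘ Fin.castSucc)` for a POLYNOMIAL `2R`-site profile `k`.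

Proof: oddness at the zero window gives `g 0 = 0`, hence `c = 0` and `G = H − τH`; the variables of
`H` at the maximal site `m` reappear shifted in `τH` and cannot be cancelled by `H`, so they are
variables of `G` and `m + 1 ≤ R`; symmetrically the minimal site is `≥ −R`; so all variables of `H`
live at sites `[-R, R−1]`, `H = rename ι pH` for the window embedding
`ι : Fin (2R) ⊕ Fin (2R) → ℤ ⊕ ℤ`, and `k := −eval pH` works.
-/

noncomputable section

namespace Summit.AtomisticToContinuum.FouriersLaw.Theorems.DressedCharge

open MvPolynomial

/-! ## Small `MvPolynomial.vars` tools -/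

/-- A variable of `q` that is not a variable of `p` is a variable of `p - q`. -/
theorem mem_vars_sub_of_notMem_left {σ S : Type*} [CommRing S] {p q : MvPolynomial σ S} {v : σ}
    (hq : v ∈ q.vars) (hp : v ∉ p.vars) : v ∈ (p - q).vars := by
  rw [mem_vars_iff_mem_support] at hq ⊢
  obtain ⟨d, hd, hv⟩ := hq
  refine ⟨d, ?_, hv⟩
  have hpd : p.coeff d = 0 := by
    by_contra h
    exact hp ((mem_vars_iff_mem_support v).mpr ⟨d, mem_support_iff.mpr h, hv⟩)
  rw [mem_support_iff, coeff_sub, hpd, zero_sub, neg_ne_zero]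
  exact mem_support_iff.mp hd

/-- A variable of `p` that is not a variable of `q` is a variable of `p - q`. -/
theorem mem_vars_sub_of_notMem_right {σ S : Type*} [CommRing S] {p q : MvPolynomial σ S} {v : σ}
    (hp : v ∈ p.vars) (hq : v ∉ q.vars) : v ∈ (p - q).vars := by
  rw [mem_vars_iff_mem_support] at hp ⊢
  obtain ⟨d, hd, hv⟩ := hp
  refine ⟨d, ?_, hv⟩
  have hqd : q.coeff d = 0 := by
    by_contra h
    exact hq ((mem_vars_iff_mem_support v).mpr ⟨d, mem_support_iff.mpr h, hv⟩)
  rw [mem_support_iff, coeff_sub, hqd, sub_zero]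
  exact mem_support_iff.mp hd

/-- Renaming along an injective map sends variables to variables. -/
theorem mem_vars_rename_of_injective {σ τ S : Type*} [CommSemiring S] {f : σ → τ}
    (hf : Function.Injective f) {p : MvPolynomial σ S} {v : σ} (hv : v ∈ p.vars) :
    f v ∈ (rename f p).vars := by
  rw [mem_vars_iff_mem_support] at hv ⊢
  obtain ⟨d, hd, hvd⟩ := hv
  refine ⟨d.mapDomain f, ?_, ?_⟩
  · rw [mem_support_iff, coeff_rename_mapDomain f hf]
    exact mem_support_iff.mp hd
  · rw [Finsupp.mem_support_iff, Finsupp.mapDomain_apply hf]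
    exact Finsupp.mem_support_iff.mp hvd

/-! ## The lattice shift on variables -/

/-- The lattice shift `τ` on variable names is injective. -/
theorem sumMap_addOne_injective :
    Function.Injective (Sum.map (fun i : ℤ => i + 1) (fun i : ℤ => i + 1)) :=
  Sum.map_injective.mpr ⟨add_left_injective 1, add_left_injective 1⟩

/-- The lattice shift `τ` raises the site of a variable by one. -/
theorem site_sumMap_addOne (v : ℤ ⊕ ℤ) :
    Sum.elim id id (Sum.map (fun i : ℤ => i + 1) (fun i : ℤ => i + 1) v) = Sum.elim id id v + 1 := by
  cases v <;> rfl

/-- **Support lemma.** If `G = H - τH` and every variable of `G` sits at a site in `[-R, R]`, then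
every variable of `H` sits at a site in `[-R, R-1]`: the top-site variables of `H` survive
(shifted) in `G`, and so do the bottom-site ones (unshifted). -/
theorem vars_site_mem_Icc_of_eq_sub_rename {R : ℕ} {G H : MvPolynomial (ℤ ⊕ ℤ) ℝ}
    (hvars : ∀ v ∈ G.vars, Sum.elim id id v ∈ Set.Icc (-(R : ℤ)) R)
    (hGH : G = H - MvPolynomial.rename (Sum.map (fun i : ℤ => i + 1) (fun i : ℤ => i + 1)) H) :
    ∀ v ∈ H.vars, Sum.elim id id v ∈ Set.Icc (-(R : ℤ)) (R - 1) := by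
  by_cases hne : H.vars.Nonempty
  swap
  · intro v hv
    exact absurd ⟨v, hv⟩ hne
  -- upper bound via a top-site variable
  obtain ⟨v₁, hv₁, hmax⟩ := Finset.exists_max_image H.vars (Sum.elim id id) hne
  have h1 : Sum.map (fun i : ℤ => i + 1) (fun i : ℤ => i + 1) v₁ ∈
      (rename (Sum.map (fun i : ℤ => i + 1) (fun i : ℤ => i + 1)) H).vars :=
    mem_vars_rename_of_injective sumMap_addOne_injective hv₁
  have h2 : Sum.map (fun i : ℤ => i + 1) (fun i : ℤ => i + 1) v₁ ∉ H.vars := by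
    intro h
    have := hmax _ h
    rw [site_sumMap_addOne] at this
    linarith
  have h3 : Sum.map (fun i : ℤ => i + 1) (fun i : ℤ => i + 1) v₁ ∈ G.vars :=
    hGH ▸ mem_vars_sub_of_notMem_left h1 h2
  have h4 := (hvars _ h3).2
  rw [site_sumMap_addOne] at h4
  -- lower bound via a bottom-site variable
  obtain ⟨v₀, hv₀, hmin⟩ := Finset.exists_min_image H.vars (Sum.elim id id) hne
  have h5 : v₀ ∉ (rename (Sum.map (fun i : ℤ => i + 1) (fun i : ℤ => i + 1)) H).vars := by
    intro h
    obtain ⟨v', hv', hv'eq⟩ := mem_vars_rename _ H h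
    have := hmin _ hv'
    rw [← hv'eq, site_sumMap_addOne] at this
    linarith
  have h6 : v₀ ∈ G.vars := hGH ▸ mem_vars_sub_of_notMem_right hv₀ h5
  have h7 := (hvars _ h6).1
  intro v hv
  exact ⟨le_trans h7 (hmin v hv), by linarith [hmax v hv]⟩

/-! ## Evaluation bookkeeping -/

/-- Evaluating `τH` at the coordinates of `σ` is evaluating `H` at the coordinates of the shifted
configuration `x ↦ σ (x + 1)`. -/
theorem eval_coord_rename_addOne (σ : ℤ → ℝ × ℝ) (H : MvPolynomial (ℤ ⊕ ℤ) ℝ) :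
    MvPolynomial.eval (Sum.elim (fun x : ℤ => (σ x).1) (fun x : ℤ => (σ x).2))
        (MvPolynomial.rename (Sum.map (fun i : ℤ => i + 1) (fun i : ℤ => i + 1)) H) =
      MvPolynomial.eval (Sum.elim (fun x : ℤ => (σ (x + 1)).1) (fun x : ℤ => (σ (x + 1)).2)) H := by
  rw [eval_rename]
  exact congrArg (fun f => MvPolynomial.eval f H) (funext fun v => by cases v <;> rfl)

/-- Evaluating `rename ι p` (window embedding `ι i = i - R`) at the coordinates of `σ` is
evaluating `p` at the window `i ↦ σ (i - R)`. -/
theorem eval_coord_rename_window (R : ℕ) (σ : ℤ → ℝ × ℝ)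
    (p : MvPolynomial (Fin (2 * R) ⊕ Fin (2 * R)) ℝ) :
    MvPolynomial.eval (Sum.elim (fun x : ℤ => (σ x).1) (fun x : ℤ => (σ x).2))
        (MvPolynomial.rename
          (Sum.map (fun i : Fin (2 * R) => (i : ℤ) - R) (fun i : Fin (2 * R) => (i : ℤ) - R)) p) =
      MvPolynomial.eval (Sum.elim (fun i : Fin (2 * R) => (σ ((i : ℤ) - R)).1)
        (fun i : Fin (2 * R) => (σ ((i : ℤ) - R)).2)) p := by
  rw [eval_rename]
  exact congrArg (fun f => MvPolynomial.eval f p) (funext fun v => by cases v <;> rfl)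

/-! ## The stub -/

/-- **Stub B (`stub_windowForm`).** If the window density `g` (sites re-indexed to `[-R, R]`,
`G` its lattice polynomial) is `G = C c + H − τH` and `g` is momentum-odd, then
`g(y) = k(y ∘ Fin.succ) − k(y ∘ Fin.castSucc)` for a POLYNOMIAL `2R`-site profile `k`. -/
theorem stub_windowForm :
    ∀ (R : ℕ) (g : (Fin (2 * R + 1) → ℝ × ℝ) → ℝ) (G H : MvPolynomial (ℤ ⊕ ℤ) ℝ) (c : ℝ),
      (∀ v ∈ G.vars, Sum.elim id id v ∈ Set.Icc (-(R : ℤ)) R) →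
      (∀ σ : ℤ → ℝ × ℝ, g (fun i : Fin (2 * R + 1) => σ ((i : ℤ) - (R : ℕ))) = MvPolynomial.eval (Sum.elim (fun x : ℤ => (σ x).1) (fun x : ℤ => (σ x).2)) G) →
      (∀ y : Fin (2 * R + 1) → ℝ × ℝ, g (fun i => ((y i).1, -(y i).2)) = -g y) →
      G = MvPolynomial.C c + H - MvPolynomial.rename (Sum.map (fun i : ℤ => i + 1) (fun i : ℤ => i + 1)) (H) →
      ∃ k : (Fin (2 * R) → ℝ × ℝ) → ℝ,
        (∃ p : MvPolynomial (Fin (2 * R) ⊕ Fin (2 * R)) ℝ, ∀ w : Fin (2 * R) → ℝ × ℝ, k w = MvPolynomial.eval (Sum.elim (fun i => (w i).1) (fun i => (w i).2)) p) ∧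
        ∀ y : Fin (2 * R + 1) → ℝ × ℝ, g y = k (fun i => y i.succ) - k (fun i => y (Fin.castSucc i)) := by
  intro R g G H c hvars heval hodd hGH
  -- the conservation law in configuration language: `g(window σ) = c + h σ - h (shift σ)`
  have key : ∀ σ : ℤ → ℝ × ℝ, g (fun i : Fin (2 * R + 1) => σ ((i : ℤ) - (R : ℕ))) =
      c + MvPolynomial.eval (Sum.elim (fun x : ℤ => (σ x).1) (fun x : ℤ => (σ x).2)) H -
        MvPolynomial.eval (Sum.elim (fun x : ℤ => (σ (x + 1)).1) (fun x : ℤ => (σ (x + 1)).2)) H := by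
    intro σ
    rw [heval σ, hGH, map_sub, map_add, eval_C, eval_coord_rename_addOne]
  -- oddness at the zero window kills the constant
  have hg0 : g (fun _ => (0, 0)) = 0 := by
    have e := hodd (fun _ => (0, 0))
    simp only [neg_zero] at e
    linarith
  have hc : c = 0 := by
    have e := key (fun _ => (0, 0))
    simp only at e
    rw [hg0] at e
    linarith
  have hGH' : G = H - MvPolynomial.rename (Sum.map (fun i : ℤ => i + 1) (fun i : ℤ => i + 1)) H := by
    rw [hGH, hc, C_0, zero_add]
  -- support: all variables of `H` live at sites `[-R, R-1]`, so `H` comes from the `2R`-window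
  have hH := vars_site_mem_Icc_of_eq_sub_rename hvars hGH'
  have hιinj : Function.Injective
      (Sum.map (fun i : Fin (2 * R) => (i : ℤ) - R) (fun i : Fin (2 * R) => (i : ℤ) - R)) := by
    refine Sum.map_injective.mpr ⟨fun a b h => ?_, fun a b h => ?_⟩
    · exact Fin.ext (by simpa using h)
    · exact Fin.ext (by simpa using h)
  have hrange : (↑H.vars : Set (ℤ ⊕ ℤ)) ⊆
      Set.range (Sum.map (fun i : Fin (2 * R) => (i : ℤ) - R) (fun i : Fin (2 * R) => (i : ℤ) - R)) := by
    intro v hv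
    obtain ⟨h1, h2⟩ := hH v hv
    cases v with
    | inl x =>
      refine ⟨Sum.inl ⟨(x + R).toNat, by simp only [Sum.elim_inl, id] at h1 h2; omega⟩, ?_⟩
      simp only [Sum.map_inl, Sum.inl.injEq]
      simp only [Sum.elim_inl, id] at h1 h2
      omega
    | inr x =>
      refine ⟨Sum.inr ⟨(x + R).toNat, by simp only [Sum.elim_inr, id] at h1 h2; omega⟩, ?_⟩
      simp only [Sum.map_inr, Sum.inr.injEq]
      simp only [Sum.elim_inr, id] at h1 h2
      omega
  obtain ⟨pH, hpH⟩ := exists_rename_eq_of_vars_subset_range H _ hιinj hrange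
  -- the profile
  refine ⟨fun w => -MvPolynomial.eval (Sum.elim (fun i => (w i).1) (fun i => (w i).2)) pH,
    ⟨-pH, fun w => by rw [map_neg]⟩, ?_⟩
  intro y
  -- embed the window `y` into a configuration (zero outside `[-R, R]`)
  set σ : ℤ → ℝ × ℝ := fun x =>
    if hx : 0 ≤ x + R ∧ x + R < 2 * R + 1 then y ⟨(x + R).toNat, by omega⟩ else (0, 0) with hσ
  have hwin : ∀ i : Fin (2 * R + 1), σ ((i : ℤ) - (R : ℕ)) = y i := by
    intro i
    have hi : (i : ℕ) < 2 * R + 1 := i.isLt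
    simp only [hσ]
    rw [dif_pos (by constructor <;> omega)]
    congr 1
    apply Fin.ext
    simp only
    omega
  have hy : (fun i : Fin (2 * R + 1) => σ ((i : ℤ) - (R : ℕ))) = y := funext hwin
  have e := key σ
  rw [hy, hc, zero_add, ← hpH, eval_coord_rename_window, eval_coord_rename_window] at e
  have hcast : (fun i : Fin (2 * R) => σ ((i : ℤ) - R)) = fun i => y (Fin.castSucc i) := by
    funext i
    have := hwin (Fin.castSucc i)
    simpa using this
  have hsucc : (fun i : Fin (2 * R) => σ ((i : ℤ) - R + 1)) = fun i => y i.succ := by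
    funext i
    have := hwin i.succ
    simp only [Fin.val_succ, Nat.cast_add, Nat.cast_one] at this
    rw [← this]
    congr 1
    ring
  rw [e]
  have e1 : (Sum.elim (fun i : Fin (2 * R) => (σ ((i : ℤ) - R)).1) fun i : Fin (2 * R) => (σ ((i : ℤ) - R)).2) =
      Sum.elim (fun i : Fin (2 * R) => (y (Fin.castSucc i)).1) fun i => (y (Fin.castSucc i)).2 := by
    have h1 : ∀ i : Fin (2 * R), σ ((i : ℤ) - R) = y (Fin.castSucc i) := fun i => congrFun hcast i
    funext v
    cases v <;> simp [h1]
  have e2 : (Sum.elim (fun i : Fin (2 * R) => (σ ((i : ℤ) - R + 1)).1) fun i : Fin (2 * R) => (σ ((i : ℤ) - R + 1)).2) =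
      Sum.elim (fun i : Fin (2 * R) => (y i.succ).1) fun i => (y i.succ).2 := by
    have h1 : ∀ i : Fin (2 * R), σ ((i : ℤ) - R + 1) = y i.succ := fun i => congrFun hsucc i
    funext v
    cases v <;> simp [h1]
  rw [e1, e2]
  ring

end Summit.AtomisticToContinuum.FouriersLaw.Theorems.DressedCharge

end
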